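import Mathlib
import HarnessLib
import Literature.MathematicalPhysics.StatisticalMechanics.PolymerProductDifference
import Literature.MathematicalPhysics.StatisticalMechanics.PolymerProductABKM

/-!
# `|F^Z − 1|_{T, W^Z} ≤ ∏_{B ∈ 𝓑(Z)} (1 + δ_B) − 1`: block products close to one ([ABKM19] Lemma 9.3 / Ch. 9.1)

In the first-order analysis of the renormalisation map `S(H,K)(U)` the prefactors
`(e^{−H̃})^{U∖X}`, `(e^{H̃})^{X∖U}` multiply the linear pieces `R K(X)`, `blockTerm(B)`; their deviation
from `1` is of first order, `|(e^{∓H̃})^Z − 1| ≤ (1 + 8e^{1/4}‖H̃‖_{k,0})^{|Z|_k} − 1`, so that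
`((e^{−H̃})^{U∖X} − 1)·R K(X)` is of second order (the `(p − 1)(κ + u)` term of
`FirstOrderCancellationBlock.firstOrder_block_identity`).  This file proves the bound, abstractly and for
the torus data:

* `one_le_expWeight_of_posSemidef`, `tayNormLE_one_of_one_le` — `W ≥ 1 ⇒ |1|_{T,W} ≤ 1`;
* `bprod_one` — `1^Z = 1`;
* **`tayNormLE_bprod_sub_one`** — abstract: `|F^Z − 1|_{T, ∏W^B} ≤ ∏_B (1 + δ_B) − 1` for
  `|F(B) − 1|_{T_B,W^B} ≤ δ_B`, `W^B ≥ 1`;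
* **`tayNormLE_expNegH_bprod_sub_one_abkm`** — torus data, strong weight `W_k^B`:
  `|(e^{−H}(·))^Z − 1|_{T, ∏_{B∈𝓑_k(Z)} W_k^B} ≤ (1 + 8e^{1/4}‖H‖_{k,0})^{|𝓑_k(Z)|} − 1` for `‖H‖_{k,0} ≤ ⅛`
  and any gauge `T` dominating the block gauges `T_k^{B*}`.

Everything is proved; no named fact.

## References
* S. Adams, S. Buchholz, R. Kotecký, S. Müller, arXiv:1910.13564, Lemma 9.3 (9.16), Ch. 9.1,
  Theorem 6.8 [AdamsBuchholzKoteckyMuller2019].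
-/

noncomputable section

namespace Literature.MathematicalPhysics.StatisticalMechanics.GradientRG

open scoped BigOperators Classical
open Finset Matrix
open Literature.MathematicalPhysics.StatisticalMechanics.TorusPolymer
  (IsPolymer blocks polys bprod blockOf thicken mem_polys mem_blocks isPolymer_blockOf)
open Literature.MathematicalPhysics.QuantumFieldTheory

variable {d M : ℕ} [NeZero M]

/-! ## Weights bounded below by one -/

/-- `e^{½(φ, Aφ)} ≥ 1` for `A ⪰ 0`. [cite: AdamsBuchholzKoteckyMuller2019, Ch. 7.1 (7.6)] -/
theorem one_le_expWeight_of_posSemidef {Λ : Type*} [Fintype Λ] [DecidableEq Λ] {A : Matrix Λ Λ ℝ}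
    (hA : A.PosSemidef) (φ : Λ → ℝ) : 1 ≤ expWeight A φ := by
  unfold expWeight
  exact Real.one_le_exp (mul_nonneg (by norm_num) (hA.dotProduct_mulVec_nonneg φ))

variable {V : Type*} [NormedAddCommGroup V] [NormedSpace ℝ V]
  {Vb : Finset (Fin d → ZMod M) → Type*} [∀ B, NormedAddCommGroup (Vb B)] [∀ B, NormedSpace ℝ (Vb B)]

/-- `|1|_{T,w} ≤ 1` for a weight `w ≥ 1`. [cite: AdamsBuchholzKoteckyMuller2019, Ch. 6.4 (6.47)] -/
theorem tayNormLE_one_of_one_le {U : Type*} [NormedAddCommGroup U] [NormedSpace ℝ U]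
    (T : ((Fin d → ZMod M) → ℝ) →ₗ[ℝ] U) (r₀ : ℕ)
    {w : ((Fin d → ZMod M) → ℝ) → ℝ} (hw : ∀ φ, 1 ≤ w φ) :
    TayNormLE T r₀ w (fun _ : (Fin d → ZMod M) → ℝ => (1 : ℂ)) 1 := fun φ => by
  rw [tayNorm_const, norm_one, one_mul]
  exact hw φ

/-- `1^Z = 1`. [cite: AdamsBuchholzKoteckyMuller2019, Ch. 6.2 (F^X)] -/
theorem bprod_one (s : ℕ) (Z : Finset (Fin d → ZMod M)) :
    bprod s (fun _ : Finset (Fin d → ZMod M) => (1 : ℂ)) Z = 1 := by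
  unfold TorusPolymer.bprod
  exact prod_const_one

/-! ## The abstract bound -/

/-- **`|F^Z − 1|_{T, ∏_B W^B} ≤ ∏_{B ∈ 𝓑(Z)} (1 + δ_B) − 1`** for an `s`-polymer `Z`, block functionals with
`|F(B) − 1|_{T_B, W^B} ≤ δ_B` (`δ_B ≥ 0`, `C^{r₀}`, local, `T_B ≤ T`) and block weights `W^B ≥ 1`.
[cite: AdamsBuchholzKoteckyMuller2019, Lemma 9.3 (9.16) / Ch. 9.1] -/
theorem tayNormLE_bprod_sub_one (s : ℕ) (T : ((Fin d → ZMod M) → ℝ) →ₗ[ℝ] V)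
    (Tb : ∀ B : Finset (Fin d → ZMod M), ((Fin d → ZMod M) → ℝ) →ₗ[ℝ] Vb B) {r₀ : ℕ}
    {W : Finset (Fin d → ZMod M) → ((Fin d → ZMod M) → ℝ) → ℝ}
    {F : Finset (Fin d → ZMod M) → ((Fin d → ZMod M) → ℝ) → ℂ} {δ : Finset (Fin d → ZMod M) → ℝ}
    {Z : Finset (Fin d → ZMod M)} (hZ : IsPolymer s Z)
    (hΔ : ∀ B ∈ blocks s Z, TayNormLE (Tb B) r₀ (W B) (fun φ => F B φ - 1) (δ B))
    (hle : ∀ B ∈ blocks s Z, ∀ ξ, ‖Tb B ξ‖ ≤ ‖T ξ‖)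
    (hFd : ∀ B ∈ blocks s Z, ContDiff ℝ r₀ (F B))
    (hFloc : ∀ B ∈ blocks s Z, IsGaugeLocal (Tb B) (F B))
    (hW : ∀ B ∈ blocks s Z, ∀ φ, 1 ≤ W B φ) (hδ : ∀ B ∈ blocks s Z, 0 ≤ δ B) :
    TayNormLE T r₀ (fun φ => ∏ B ∈ blocks s Z, W B φ)
      (fun φ => bprod s (fun B => F B φ) Z - 1) ((∏ B ∈ blocks s Z, (1 + δ B)) - 1) := by
  have h1 : ∀ B ∈ blocks s Z, TayNormLE (Tb B) r₀ (W B) (fun _ : (Fin d → ZMod M) → ℝ => (1 : ℂ)) 1 :=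
    fun B hB => tayNormLE_one_of_one_le (Tb B) r₀ (hW B hB)
  have h := tayNormLE_bprod_sub_bprod s T Tb (F' := fun _ _ => (1 : ℂ)) (a := fun _ => (1 : ℝ)) hZ h1 hΔ hle
    hFd (fun _ _ => contDiff_const) hFloc (fun _ _ _ _ _ => rfl) (fun _ _ => zero_le_one) hδ
  have hfun : (fun φ => bprod s (fun B => F B φ) Z - bprod s (fun _ : Finset (Fin d → ZMod M) => (1 : ℂ)) Z) =
      fun φ => bprod s (fun B => F B φ) Z - 1 := by
    funext φ; rw [bprod_one]
  rw [hfun, prod_const_one] at h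
  exact h

/-! ## The torus data: `(e^{−H})^Z − 1` -/

/-- **`|(e^{−H})^Z − 1|_{T, ∏_{B ∈ 𝓑_k(Z)} W_k^B} ≤ (1 + 8e^{1/4}‖H‖_{k,0})^{|𝓑_k(Z)|} − 1`** for the torus tower
(strong weights `W_k^B`, `d ≥ 2`, `L` odd, `M = L^N`, `k ≤ N`, `⌊d/2⌋+1 ≤ p, M_ord`, `h > 0`), a
`k`-polymer `Z`, `‖H‖_{k,0} ≤ ⅛` at `(𝔥_k, L^k, L^{dk})`, and any gauge `T` dominating the block gauges
`T_k^{B*}`, `B ∈ 𝓑_k(Z)`.  (Apply with `H̃` and with `−H̃` for the two prefactors of the reblocked terms.)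
[cite: AdamsBuchholzKoteckyMuller2019, Lemma 9.3 (9.16) / Ch. 9.1] -/
theorem tayNormLE_expNegH_bprod_sub_one_abkm {L N Mord R p r₀ : ℕ} {h θbar A : ℝ} {δ' : ℕ → ℝ}
    {𝒞 : ℕ → (Fin d → ZMod M) → ℝ} (hd : 2 ≤ d) (hLodd : Odd L) (hM : M = L ^ N) {k : ℕ} (hk : k ≤ N)
    (hh : 0 < h) (hMord : d / 2 + 1 ≤ Mord) (hp : d / 2 + 1 ≤ p)
    {Z : Finset (Fin d → ZMod M)} (hZ : IsPolymer (L ^ k) Z)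
    (T : ((Fin d → ZMod M) → ℝ) →ₗ[ℝ] V)
    (hle : ∀ B ∈ blocks (L ^ k) Z, ∀ ξ,
      ‖(abkmNormParams L N Mord R p r₀ h θbar A δ' 𝒞).gauge k B ξ‖ ≤ ‖T ξ‖)
    {H : RelevantHamiltonian ℂ d}
    (hH : hamNorm (fieldWt h (L : ℝ) d k) ((L : ℝ) ^ k) (L ^ (d * k)) H ≤ 1 / 8) :
    TayNormLE T r₀
      (fun φ => ∏ B ∈ blocks (L ^ k) Z, expWeight (strongCoef h N k • derivForm (L : ℝ) k (diffIndex d Mord)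
        (boxDensity (boxRad R L k) (boxWt (L : ℝ) d k) B)) φ)
      (fun φ => bprod (L ^ k) (fun B => expNegH H B φ) Z - 1)
      ((∏ _B ∈ blocks (L ^ k) Z,
          (1 + 8 * Real.exp (1 / 4) * hamNorm (fieldWt h (L : ℝ) d k) ((L : ℝ) ^ k) (L ^ (d * k)) H)) - 1) := by
  set P := abkmNormParams L N Mord R p r₀ h θbar A δ' 𝒞 with hP
  set s := L ^ k with hs
  have hL0 : (0 : ℝ) < L := by exact_mod_cast hLodd.pos
  obtain ⟨t, ht⟩ : ∃ t, N = k + t := ⟨N - k, by omega⟩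
  have hMt : M = s * L ^ t := by rw [hs, ← pow_add, ← ht]; exact hM
  have htodd : Odd (L ^ t) := hLodd.pow
  have hsodd : Odd s := hLodd.pow
  have h𝔥 : 0 < P.𝔥 k := fieldWt_pos hh hL0 d k
  have hR : 0 < P.R k := by show (0 : ℝ) < (L : ℝ) ^ k; positivity
  have hcard : ∀ x, (blockOf s x).card = L ^ (d * k) := fun x => by
    rw [TorusPolymer.card_blockOf hMt hsodd htodd x, hs, ← pow_mul, mul_comm]
  set G : Finset (Fin d → ZMod M) → Matrix (Fin d → ZMod M) (Fin d → ZMod M) ℝ :=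
    fun Y => strongCoef h N k • derivForm (L : ℝ) k (diffIndex d Mord)
      (boxDensity (boxRad R L k) (boxWt (L : ℝ) d k) Y) with hG
  have hGpsd : ∀ B, (G B).PosSemidef := fun B =>
    (posSemidef_derivForm hL0.le k _ fun y => boxDensity_nonneg _ (by unfold boxWt; positivity) _ y).smul
      (strongCoef_nonneg h N k)
  have hΔ : ∀ B ∈ blocks s Z, TayNormLE (P.gauge k B) r₀ (expWeight (G B))
      (fun φ => expNegH H B φ - 1)
      (8 * Real.exp (1 / 4) * hamNorm (fieldWt h (L : ℝ) d k) ((L : ℝ) ^ k) (L ^ (d * k)) H) := by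
    intro B hBm
    obtain ⟨x, -, rfl⟩ := mem_blocks.1 hBm
    have hH' : hamNorm (fieldWt h (L : ℝ) d k) ((L : ℝ) ^ k) (blockOf s x).card H ≤ 1 / 8 := by
      rw [hcard x]; exact hH
    have := tayNormLE_expNegH_sub_one_strong_abkm (R := R) (N := N) (Mord := Mord) hd hLodd hM hk hh
      hMord hp (TorusPolymer.subset_thicken (P.rad k) (blockOf s x)) r₀ hH'
    rw [hcard x] at this
    exact this
  have hFd : ∀ B ∈ blocks s Z, ContDiff ℝ r₀ (fun φ : (Fin d → ZMod M) → ℝ => expNegH H B φ) :=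
    fun B _ => (contDiff_eval H B (n := r₀)).neg.cexp
  have hFloc : ∀ B ∈ blocks s Z, IsGaugeLocal (P.gauge k B) (fun φ : (Fin d → ZMod M) → ℝ => expNegH H B φ) :=
    fun B _ => isGaugeLocal_cexp_neg_eval h𝔥.ne' hR.ne' hp (TorusPolymer.subset_thicken _ _) H
  have hW : ∀ B ∈ blocks s Z, ∀ φ, 1 ≤ expWeight (G B) φ := fun B _ φ =>
    one_le_expWeight_of_posSemidef (hGpsd B) φ
  have hδ : ∀ B ∈ blocks s Z, (0 : ℝ) ≤
      8 * Real.exp (1 / 4) * hamNorm (fieldWt h (L : ℝ) d k) ((L : ℝ) ^ k) (L ^ (d * k)) H := fun _ _ => by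
    have := hamNorm_nonneg (fieldWt_pos hh hL0 d k).le (by positivity : (0 : ℝ) ≤ (L : ℝ) ^ k) (L ^ (d * k)) H
    positivity
  exact tayNormLE_bprod_sub_one s T (fun B => P.gauge k B) (W := fun B => expWeight (G B))
    (F := fun B φ => expNegH H B φ) hZ hΔ hle hFd hFloc hW hδ

end Literature.MathematicalPhysics.StatisticalMechanics.GradientRG

end
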